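import Summits.NavierStokesRegularity.NavierStokesRegularity.Theses.ExtremalTypeIConstant
import Literature.Analysis.FluidPDE.TsaiSelfSimilarBounded

/-!
# Route ExtremalTypeIConstant — support `BoundedProfileConstant`

Item stmt-NavierStokesRegularity-8220: Tsai 1998, Theorem 1 at `q = ∞` for the tree's pointwise
profile class — a Leray profile `(U, P)` (`IsLerayProfile ν a U P`, `ν, a > 0`) with `U` bounded is
constant.  This is exactly the in-tree discharged Literature theorem
`Literature.Analysis.FluidPDE.IsLerayProfile.exists_eq_const_of_bounded`
(`TsaiSelfSimilarBounded.lean`: Lemma 3.2 at `q = ∞`, head-pressure maximum principle Lemma 5.1,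
`ΔU = 0`, bounded harmonic Liouville), so the proof is a direct application.
-/

namespace Summit.NavierStokesRegularity.NavierStokesRegularity.Theorems

/-- **Route ExtremalTypeIConstant, support `BoundedProfileConstant`** (item
stmt-NavierStokesRegularity-8220): a bounded Leray profile is constant — Tsai 1998, Theorem 1,
`q = ∞`, via `Literature.Analysis.FluidPDE.IsLerayProfile.exists_eq_const_of_bounded`. -/
theorem boundedProfileConstant_proof :
    Summit.NavierStokesRegularity.NavierStokesRegularity.Theses.ExtremalTypeIConstant.BoundedProfileConstant := by
  intro ν a hν ha U P hprof hU
  exact Literature.Analysis.FluidPDE.IsLerayProfile.exists_eq_const_of_bounded hν ha hprof hU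

end Summit.NavierStokesRegularity.NavierStokesRegularity.Theorems
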